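import Summits.ResolutionOfSingularities.ResolutionOfSingularities.Theses.UniversalCells

/-!
# `UniversalCells.ProductDescent` (crux stmt-ResolutionOfSingularities-15231), line `birth`
# (rev L5, the `p`-th power section cut): the registered stub `stub_sliceWiggle`
# ("WIGGLING THE SECTION") is FALSE as stated — refuter crux-attack seat (cdisprove),
# negative-side support; this file does NOT refute the crux.

The stub registered in `Cruxes/ProductDescent/Lines/birth.lean` reads (with that file's `open`s)

  ∀ p prime, ∀ (Y : Scheme) [IsIntegral Y] (s : ℕ) (V₁ : (𝔸ˢ_Y).Opens) (X₁ : Scheme)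
    (π : X₁ ⟶ V₁), IsBirational π →
    ∀ (V : Y.Opens) (y : Y) (hyV : y ∈ V), y ≠ genericPoint Y → ∀ g : Fin s → Γ(V, ⊤),
    ∃ V' ∋ y, ∃ g' : Fin s → Γ(V', ⊤), σ_{g'}(y) = σ_g(y) ∧
      ∃ Ω : (𝔸ˢ_Y).Opens, Ω ≤ V₁ ∧ IsIso (π ∣_ (V₁.ι ⁻¹ᵁ Ω)) ∧
        ∀ x : V', V'.ι x = genericPoint Y → σ_{g'}(x) ∈ Ω

(`σ_g = AffineSpace.homOfVector V.ι (gᵢᵖ)ᵢ`, the `p`-th power section). Nothing forces the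
birational model to be NON-EMPTY: `Literature.AlgebraicGeometry.Resolution.IsBirational` holds for
the identity of the EMPTY scheme (`U = ⊤` is dense with dense preimage and `𝟙 ∣_ ⊤` is an
isomorphism), so `V₁ = ⊥`, `X₁ = ↑⊥`, `π = 𝟙` satisfy every hypothesis, while the conclusion then
asks for an open `Ω ≤ ⊥` containing the value of a section at the generic point of `Y` — and the
generic point lies in every open `V' ∋ y`. Hence (all sorry-free, no definition declared):

* `sliceWiggle_conclusion_false_of_bot` — for EVERY `p`, every integral `Y`, every `s`, `V`,
  `y ∈ V`, `g` and every `π : X₁ ⟶ ↑(⊥ : (𝔸ˢ_Y).Opens)`, the stub's conclusion is false;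
* `isBirational_id_bot` — … while its hypothesis `IsBirational (𝟙 ↑⊥)` holds;
* `stub_sliceWiggle_false_at` — so for every prime `p` the stub's body at `p` is false (witness
  `Y = 𝔸¹_{𝔽_p} = Spec 𝔽_p[X]`, `y = (X) ≠ η`, `s = 0`, `V₁ = ⊥`, `X₁ = ↑⊥`, `π = 𝟙`);
* `stub_sliceWiggle_false` — the registered signature, negated verbatim.

CLASS: stub-misstated (a degenerate instance, not the mechanism). REPAIR (what
`ProductDescent_proof` actually has in hand, as `hb`): insert the hypothesis
`(AffineSpace.homOfVector V.ι (fun i => g i ^ p)).base ⟨y, hyV⟩ ∈ V₁ →` after `∀ g …,` (or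
`Nonempty X₁ →`). With it the stub is true on paper: `Ω :=` the image in `𝔸ˢ_Y` of the dense open
of `IsBirational π` (now non-empty, so it meets the generic fibre `𝔸ˢ_K`, `K = κ(η_Y)`, in a
non-empty open); `y ≠ η_Y` on an integral `Y` means `𝔪_{Y,y} ≠ 0`, so `𝔪_{Y,y}` is infinite and
the non-zero polynomial `F(gᵖ + uᵖ) ∈ K[u₁,…,u_s]` (`F ≠ 0` vanishing off `Ω_K`) does not vanish
on `𝔪_{Y,y}ˢ`; take `g' = g + h` for such an `h`, spread over a neighbourhood `V'` of `y`. The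
witness below does not bite the repaired statement.
-/

noncomputable section

-- single-problem summit: the doubled namespace component `ResolutionOfSingularities` is forced
set_option linter.dupNamespace false

open CategoryTheory CategoryTheory.Limits AlgebraicGeometry Literature.AlgebraicGeometry.Resolution

namespace Summit.ResolutionOfSingularities.ResolutionOfSingularities.Theorems.ProductDescent.Negative

/-- Over the EMPTY open `V₁ = ⊥ ⊆ 𝔸ˢ_Y` the conclusion of `stub_sliceWiggle` fails for every
integral `Y`, every `y ∈ V`, every section data `g` and every `π : X₁ ⟶ ↑⊥`: an open `Ω ≤ ⊥` is
empty, yet it should contain the section's value at the generic point of `Y`, which lies in every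
open neighbourhood `V'` of `y`. [folklore] -/
theorem sliceWiggle_conclusion_false_of_bot (p : ℕ) (Y : Scheme.{0}) [IsIntegral Y] (s : ℕ)
    (X₁ : Scheme.{0}) (π : X₁ ⟶ ((⊥ : (AffineSpace (Fin s) Y).Opens) : Scheme.{0}))
    (V : Y.Opens) (y : Y) (hyV : y ∈ V) (g : Fin s → Γ((V : Scheme.{0}), ⊤)) :
    ¬ ∃ (V' : Y.Opens) (hyV' : y ∈ V') (g' : Fin s → Γ((V' : Scheme.{0}), ⊤)),
        (AffineSpace.homOfVector V'.ι (fun i => g' i ^ p)).base ⟨y, hyV'⟩ =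
          (AffineSpace.homOfVector V.ι (fun i => g i ^ p)).base ⟨y, hyV⟩ ∧
        ∃ Ω : (AffineSpace (Fin s) Y).Opens, Ω ≤ ⊥ ∧
          IsIso (π ∣_ ((⊥ : (AffineSpace (Fin s) Y).Opens).ι ⁻¹ᵁ Ω)) ∧
          ∀ x : (V' : Scheme.{0}), V'.ι.base x = genericPoint Y →
            (AffineSpace.homOfVector V'.ι (fun i => g' i ^ p)).base x ∈ Ω := by
  rintro ⟨V', hyV', g', -, Ω, hΩ, -, hgen⟩
  have hηV' : genericPoint Y ∈ V' :=
    ((genericPoint_spec Y).mem_open_set_iff V'.isOpen).mpr ⟨y, trivial, hyV'⟩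
  exact (TopologicalSpace.Opens.mem_bot).mp (hΩ (hgen ⟨genericPoint Y, hηV'⟩ rfl))

/-- … while the stub's only hypothesis on the model is satisfied there: the identity of the empty
scheme `↑(⊥ : (𝔸ˢ_Y).Opens)` is birational (`U = ⊤`, dense with dense preimage, `𝟙 ∣_ ⊤` an
isomorphism) — `IsBirational` does not exclude the empty scheme. [folklore] -/
theorem isBirational_id_bot (Y : Scheme.{0}) (s : ℕ) :
    IsBirational (𝟙 (((⊥ : (AffineSpace (Fin s) Y).Opens) : Scheme.{0}))) :=
  ⟨⊤, by simp [dense_univ], by simp [dense_univ], inferInstance⟩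

/-- For every prime `p` the body of `stub_sliceWiggle` at `p` is false: take `Y = Spec 𝔽_p[X]`
(integral), `y = (X)` (not the generic point `(0)`), `s = 0`, `V₁ = ⊥`, `X₁ = ↑⊥`, `π = 𝟙`,
`V = ⊤`, `g` the empty family. [folklore] -/
theorem stub_sliceWiggle_false_at (p : ℕ) (hp : p.Prime) :
    ¬ ∀ (Y : Scheme.{0}) [IsIntegral Y] (s : ℕ) (V₁ : (AffineSpace (Fin s) Y).Opens)
      (X₁ : Scheme.{0}) (π : X₁ ⟶ (V₁ : Scheme.{0})), IsBirational π →
      ∀ (V : Y.Opens) (y : Y) (hyV : y ∈ V), y ≠ genericPoint Y →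
      ∀ g : Fin s → Γ((V : Scheme.{0}), ⊤),
      ∃ (V' : Y.Opens) (hyV' : y ∈ V') (g' : Fin s → Γ((V' : Scheme.{0}), ⊤)),
        (AffineSpace.homOfVector V'.ι (fun i => g' i ^ p)).base ⟨y, hyV'⟩ =
          (AffineSpace.homOfVector V.ι (fun i => g i ^ p)).base ⟨y, hyV⟩ ∧
        ∃ Ω : (AffineSpace (Fin s) Y).Opens, Ω ≤ V₁ ∧ IsIso (π ∣_ (V₁.ι ⁻¹ᵁ Ω)) ∧
          ∀ x : (V' : Scheme.{0}), V'.ι.base x = genericPoint Y →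
            (AffineSpace.homOfVector V'.ι (fun i => g' i ^ p)).base x ∈ Ω := by
  intro h
  haveI : Fact p.Prime := ⟨hp⟩
  let Y : Scheme.{0} := Spec (.of (Polynomial (ZMod p)))
  have hprime : (Ideal.span {(Polynomial.X : Polynomial (ZMod p))}).IsPrime := by
    rw [Ideal.span_singleton_prime Polynomial.X_ne_zero]
    exact Polynomial.prime_X
  let y : Y := (⟨Ideal.span {Polynomial.X}, hprime⟩ : PrimeSpectrum (Polynomial (ZMod p)))
  have hy : y ≠ genericPoint Y := by
    intro hyη
    have h1 : y.asIdeal = (⊥ : Ideal (Polynomial (ZMod p))) := by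
      rw [hyη]
      exact congrArg PrimeSpectrum.asIdeal (genericPoint_eq_bot_of_affine _)
    have h2 : (Polynomial.X : Polynomial (ZMod p)) ∈ y.asIdeal := Ideal.subset_span rfl
    rw [h1, Ideal.mem_bot] at h2
    exact Polynomial.X_ne_zero h2
  exact sliceWiggle_conclusion_false_of_bot p Y 0 _ (𝟙 _) ⊤ y trivial (fun _ => 0)
    (h Y 0 ⊥ _ (𝟙 _) (isBirational_id_bot Y 0) ⊤ y trivial hy (fun _ => 0))

/-- **The registered stub `stub_sliceWiggle` of line `birth` (rev L5) is false as stated**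
(its signature, negated verbatim; instantiate at `p = 2`). Misstated, not substantive: see the
module docstring for the one-hypothesis repair, which the witness misses. [folklore] -/
theorem stub_sliceWiggle_false :
    ¬ ∀ p : ℕ, p.Prime → ∀ (Y : Scheme.{0}) [IsIntegral Y] (s : ℕ)
      (V₁ : (AffineSpace (Fin s) Y).Opens)
      (X₁ : Scheme.{0}) (π : X₁ ⟶ (V₁ : Scheme.{0})), IsBirational π →
      ∀ (V : Y.Opens) (y : Y) (hyV : y ∈ V), y ≠ genericPoint Y →
      ∀ g : Fin s → Γ((V : Scheme.{0}), ⊤),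
      ∃ (V' : Y.Opens) (hyV' : y ∈ V') (g' : Fin s → Γ((V' : Scheme.{0}), ⊤)),
        (AffineSpace.homOfVector V'.ι (fun i => g' i ^ p)).base ⟨y, hyV'⟩ =
          (AffineSpace.homOfVector V.ι (fun i => g i ^ p)).base ⟨y, hyV⟩ ∧
        ∃ Ω : (AffineSpace (Fin s) Y).Opens, Ω ≤ V₁ ∧ IsIso (π ∣_ (V₁.ι ⁻¹ᵁ Ω)) ∧
          ∀ x : (V' : Scheme.{0}), V'.ι.base x = genericPoint Y →
            (AffineSpace.homOfVector V'.ι (fun i => g' i ^ p)).base x ∈ Ω :=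
  fun h => stub_sliceWiggle_false_at 2 Nat.prime_two (h 2 Nat.prime_two)

end Summit.ResolutionOfSingularities.ResolutionOfSingularities.Theorems.ProductDescent.Negative

end
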